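import Literature.Topology.FourManifolds.Diffeotopy
import HarnessLib

/-!
# Transport of a compactly supported diffeotopy along a partial diffeomorphism

Topic `Literature/Topology/FourManifolds`; a complement to `DiffeotopyTransport.lean`, whose
`Diffeotopy.chartTransport` transports a diffeotopy of the model vector space `E`, stationary
off a ball, along a chart `φ : M ⊇ U → E` **onto the whole of `E`**.  Here the chart is replaced
by an arbitrary **partial diffeomorphism** `ψ : M ⊇ U ⇀ V ⊆ N` between manifolds (an open partial
homeomorphism, `C^∞` on its source with `C^∞` inverse on its target) and the diffeotopy `D` of
`N` is assumed stationary, together with its inverse stages, off a **compact subset `K` of the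
target `V`**:

* `Diffeotopy.exists_partialTransport` — there is a diffeotopy `D'` of `M` with
  `D'_t = ψ⁻¹ ∘ D_t ∘ ψ` on `U` and `D'_t = id` off `U`, for all `t` (hence `D'_t = id` off the
  compact `ψ⁻¹(K)`).

This is the extension by the identity of a compactly supported diffeotopy of an open subset
(Hirsch, *Differential Topology* (1976), Ch. 8 §1, Thms. 1.3–1.4), in the form needed to move
tubes inside a 3-manifold: a diffeotopy of a solid-torus chart (`S¹ × ℝ² ⊇ S¹ × B ⇀ Y`) or of a
model solid torus in `ℝ³`, supported in a smaller compact tube, becomes a diffeotopy of `Y`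
(`Geometry/Symplectic/TwoHandleIsotopy.lean`).  Proof: the stages preserve the target (a
bijection of `N` which is the identity off `K` maps `K` onto `K`), so near `ℝ × U` the family is
the composite `ψ⁻¹ ∘ D ∘ ψ` of smooth maps, and near the closed set `ℝ × (M ∖ ψ⁻¹(K))` it is the
identity; `Diffeotopy.mk'` packages the two families.  Everything here is proved; no definition
and no named fact is introduced.

## References

* M. W. Hirsch, *Differential Topology*, GTM 33, Springer (1976), Ch. 8 §1, Thms. 1.3–1.4.
  [HirschDT1976]
-/

open scoped Manifold ContDiff Topology
open Set Function Filter

noncomputable section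

namespace Literature.Topology.FourManifolds

namespace Diffeotopy

variable {EM HM EN HN : Type*} [NormedAddCommGroup EM] [NormedSpace ℝ EM] [TopologicalSpace HM]
  [NormedAddCommGroup EN] [NormedSpace ℝ EN] [TopologicalSpace HN]
  {J : ModelWithCorners ℝ EM HM} {J' : ModelWithCorners ℝ EN HN}
  {M : Type*} [TopologicalSpace M] [ChartedSpace HM M]
  {N : Type*} [TopologicalSpace N] [ChartedSpace HN N]

/-- **A bijection which is the identity off `K` maps `K` into `K`** (if `f x ∉ K` for `x ∈ K`
then `f (f x) = f x`, so `f x = x ∈ K`). [folklore] -/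
theorem mapsTo_of_eq_self_off {α : Type*} {f : α → α} (hf : Injective f) {K : Set α}
    (h : ∀ y, y ∉ K → f y = y) : MapsTo f K K := by
  intro x hx
  by_contra hfx
  have h1 : f (f x) = f x := h _ hfx
  have h2 : f x = x := hf h1
  rw [h2] at hfx
  exact hfx hx

/-- **Transport of a compactly supported diffeotopy along a partial diffeomorphism.**  Let
`ψ : M ⇀ N` be an open partial homeomorphism, `C^∞` on its source with `C^∞` inverse on its
target (`M` Hausdorff), and `D` a diffeotopy of `N` whose stages and inverse stages are all the
identity off a compact subset `K` of the target of `ψ`.  Then there is a diffeotopy `D'` of `M`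
with `D'_t x = ψ⁻¹ (D_t (ψ x))` for `x` in the source and `D'_t x = x` off the source, for all
`t`. [cite: HirschDT1976, Ch. 8 §1, Thm. 1.3] -/
theorem exists_partialTransport [T2Space M] (ψ : OpenPartialHomeomorph M N)
    (hψ : ContMDiffOn J J' ∞ ψ ψ.source) (hψ' : ContMDiffOn J' J ∞ ψ.symm ψ.target)
    (D : Diffeotopy J' N) {K : Set N} (hK : IsCompact K) (hKψ : K ⊆ ψ.target)
    (hD : ∀ t y, y ∉ K → D.toFun t y = y) (hD' : ∀ t y, y ∉ K → D.invFun t y = y) :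
    ∃ D' : Diffeotopy J M, (∀ t, ∀ x ∈ ψ.source, D'.toFun t x = ψ.symm (D.toFun t (ψ x))) ∧
      ∀ t x, x ∉ ψ.source → D'.toFun t x = x := by
  classical
  -- the stages preserve the target of `ψ`
  have hpres : ∀ (F : ℝ → N → N), (∀ t, Injective (F t)) → (∀ t y, y ∉ K → F t y = y) →
      ∀ t, ∀ y ∈ ψ.target, F t y ∈ ψ.target := by
    intro F hFi hFs t y hy
    by_cases hyK : y ∈ K
    · exact hKψ (mapsTo_of_eq_self_off (hFi t) (hFs t) hyK)
    · rw [hFs t y hyK]; exact hy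
  have hinjD : ∀ t, Injective (D.toFun t) := fun t => (D.stage t).injective
  have hinjD' : ∀ t, Injective (D.invFun t) := fun t => (D.stage t).symm.injective
  have hpresD := hpres D.toFun hinjD hD
  have hpresD' := hpres D.invFun hinjD' hD'
  -- the compact `ψ⁻¹(K)` is closed and lies in the source
  set C : Set M := ψ.symm '' K with hC
  have hCc : IsClosed C :=
    (hK.image_of_continuousOn (ψ.continuousOn_symm.mono hKψ)).isClosed
  have hCsrc : C ⊆ ψ.source := by
    rintro _ ⟨y, hy, rfl⟩
    exact ψ.map_target (hKψ hy)
  -- the two families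
  set F : (ℝ → N → N) → ℝ → M → M := fun Fam t x =>
    if x ∈ ψ.source then ψ.symm (Fam t (ψ x)) else x with hF
  have hF_of_mem : ∀ (Fam : ℝ → N → N) (t) {x}, x ∈ ψ.source →
      F Fam t x = ψ.symm (Fam t (ψ x)) := fun Fam t x hx => by simp only [hF, if_pos hx]
  have hF_of_not_mem : ∀ (Fam : ℝ → N → N) (t) {x}, x ∉ ψ.source → F Fam t x = x :=
    fun Fam t x hx => by simp only [hF, if_neg hx]
  -- off `C` every transported stage is the identity
  have hF_of_not_mem_C : ∀ (Fam : ℝ → N → N), (∀ t y, y ∉ K → Fam t y = y) →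
      ∀ t {x}, x ∉ C → F Fam t x = x := by
    intro Fam hFs t x hxC
    by_cases hx : x ∈ ψ.source
    · have hψx : ψ x ∉ K := fun h => hxC ⟨ψ x, h, ψ.left_inv hx⟩
      rw [hF_of_mem Fam t hx, hFs t _ hψx, ψ.left_inv hx]
    · exact hF_of_not_mem Fam t hx
  -- joint smoothness of a transported family
  have key : ∀ (Fam : ℝ → N → N), ContMDiff (𝓘(ℝ, ℝ).prod J') J' ∞ (uncurry Fam) →
      (∀ t y, y ∉ K → Fam t y = y) → (∀ t, ∀ y ∈ ψ.target, Fam t y ∈ ψ.target) →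
      ContMDiff (𝓘(ℝ, ℝ).prod J) J ∞ (uncurry (F Fam)) := by
    intro Fam hFam hFs hFt p
    obtain ⟨t, x⟩ := p
    by_cases hxs : x ∈ ψ.source
    · -- near `ℝ × source` the family is `ψ⁻¹ ∘ Fam_t ∘ ψ`
      have hev : uncurry (F Fam) =ᶠ[𝓝 (t, x)] fun q : ℝ × M => ψ.symm (Fam q.1 (ψ q.2)) := by
        filter_upwards [prod_mem_nhds univ_mem (ψ.open_source.mem_nhds hxs)] with q hq
        exact hF_of_mem Fam q.1 hq.2
      refine ContMDiffAt.congr_of_eventuallyEq ?_ hev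
      have h1 : ContMDiffAt (𝓘(ℝ, ℝ).prod J) (𝓘(ℝ, ℝ).prod J') ∞
          (fun q : ℝ × M => (q.1, ψ q.2)) (t, x) :=
        contMDiffAt_fst.prodMk ((hψ.contMDiffAt (ψ.open_source.mem_nhds hxs)).comp (t, x)
          contMDiffAt_snd)
      have h2 : ContMDiffAt (𝓘(ℝ, ℝ).prod J) J' ∞ (fun q : ℝ × M => Fam q.1 (ψ q.2)) (t, x) :=
        hFam.contMDiffAt.comp (t, x) h1
      have h3 : ContMDiffAt J' J ∞ ψ.symm (Fam t (ψ x)) :=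
        hψ'.contMDiffAt (ψ.open_target.mem_nhds (hFt t _ (ψ.map_source hxs)))
      exact h3.comp (t, x) h2
    · -- near `ℝ × (M ∖ C)` the family is the identity
      have hxC : x ∉ C := fun h => hxs (hCsrc h)
      have hev : uncurry (F Fam) =ᶠ[𝓝 (t, x)] fun q : ℝ × M => q.2 := by
        filter_upwards [prod_mem_nhds univ_mem (hCc.isOpen_compl.mem_nhds hxC)] with q hq
        exact hF_of_not_mem_C Fam hFs q.1 hq.2
      exact contMDiffAt_snd.congr_of_eventuallyEq hev
  -- inverse relations
  have hGF : ∀ t x, F D.invFun t (F D.toFun t x) = x := by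
    intro t x
    by_cases hx : x ∈ ψ.source
    · have h1 : D.toFun t (ψ x) ∈ ψ.target := hpresD t _ (ψ.map_source hx)
      have h2 : ψ.symm (D.toFun t (ψ x)) ∈ ψ.source := ψ.map_target h1
      rw [hF_of_mem _ t hx, hF_of_mem _ t h2, ψ.right_inv h1, D.invFun_toFun, ψ.left_inv hx]
    · rw [hF_of_not_mem _ t hx, hF_of_not_mem _ t hx]
  have hFG : ∀ t y, F D.toFun t (F D.invFun t y) = y := by
    intro t y
    by_cases hy : y ∈ ψ.source
    · have h1 : D.invFun t (ψ y) ∈ ψ.target := hpresD' t _ (ψ.map_source hy)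
      have h2 : ψ.symm (D.invFun t (ψ y)) ∈ ψ.source := ψ.map_target h1
      rw [hF_of_mem _ t hy, hF_of_mem _ t h2, ψ.right_inv h1, D.toFun_invFun, ψ.left_inv hy]
    · rw [hF_of_not_mem _ t hy, hF_of_not_mem _ t hy]
  have hF0 : F D.toFun 0 = id := by
    funext x
    by_cases hx : x ∈ ψ.source
    · rw [hF_of_mem _ 0 hx, D.toFun_zero, id, id, ψ.left_inv hx]
    · rw [hF_of_not_mem _ 0 hx, id]
  refine ⟨Diffeotopy.mk' J (F D.toFun) (F D.invFun)
    (key D.toFun D.contMDiff_uncurry_toFun hD hpresD)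
    (key D.invFun D.contMDiff_uncurry_invFun hD' hpresD') hGF hFG hF0, fun t x hx => ?_,
    fun t x hx => ?_⟩
  · rw [Diffeotopy.mk'_toFun]; exact hF_of_mem _ t hx
  · rw [Diffeotopy.mk'_toFun]; exact hF_of_not_mem _ t hx

end Diffeotopy

end Literature.Topology.FourManifolds

end
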